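import Summits.CriticalPhenomena.PercolationContinuityZ3.Theorems.PercNearOneGluingNoHeavyLowerTailSahiSymCubeSound
import Summits.CriticalPhenomena.PercolationContinuityZ3.Theorems.PercNearOneGluingNoHeavyLowerTailSahiSymCubeFive5A
import Summits.CriticalPhenomena.PercolationContinuityZ3.Theorems.PercNearOneGluingNoHeavyLowerTailSahiSymCubeFive5B
import Summits.CriticalPhenomena.PercolationContinuityZ3.Theorems.PercNearOneGluingNoHeavyLowerTailSahiSymCubeFive5C
import Summits.CriticalPhenomena.PercolationContinuityZ3.Theorems.PercNearOneGluingNoHeavyLowerTailSahiSymCubeFive5D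
import Summits.CriticalPhenomena.PercolationContinuityZ3.Theorems.PercNearOneGluingNoHeavyLowerTailSahiC4CubeFive

/-!
# SAHI'S `C₅` ON THE CUBE `{0,1}^5` FOR EVERY PRODUCT MEASURE (Lean): assembly of the symmetry-reduced coloured-antichain check of order 5

Support file (cell `prim-sahi`, seat `prim-sahi-typer` gen 29; `--supports stmt-CriticalPhenomena-4575`).  Pure proofs; the closure of the main
theorems is standard axioms + the `native_decide` axioms of the four computational chunks …`SahiSymCubeFive5A–D` (4 429 order-5 digit tests:
one coloured antichain per orbit of `S_5 × S_5`, against `436 266` restricted-growth colourings / `109 380` axis representatives of the cell's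
external census, typer gen 28 §6) + those behind `SahiC4Cube.sahiPositive_bernoulliWeight_fin_five_of_le_four` (orders `3, 4` on five coins,
typer gen 27/28).

* `symCheck_five_five : symCheck 5 5 33 = true` (from the chunks, `symCheckFrom_of_range`);
* **`sahiPositive_bernoulliWeight_five_fin_five`**: `SahiPositive (bernoulliWeight p) 5` for every `p : Fin 5 → [0,1]` — Sahi's Conjecture 5
  at order `5` (`C₅`) for five independent coins with arbitrary biases: `E₅(f₁,…,f₅) ≥ 0` for all nonnegative increasing `fᵢ` on `2^{Fin 5}`;
* `sahiC5_cube_five` — events form; `sahiPositive_bernoulliWeight_fin_five_of_le_five` — every order `n ≤ 5`.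
Tree frontier before: orders `≤ 4` on five coins (`sahiC4_cube_five`), all orders on four coins (`NCopyCert.sahiPositive_bernoulliWeight_fin_four`).
[this work]
-/

namespace Summit.CriticalPhenomena.PercolationContinuityZ3.Theorems.SahiSymCube

open Literature.Combinatorics.Sahi2008
open Literature.Probability.Percolation.DecisionTree (ind)

/-- **The order-5 symmetry-reduced check on `{0,1}^5` passes** (assembled from the four computational chunks). [this work] -/
theorem symCheck_five_five : symCheck 5 5 33 = true :=
  symCheck_of_from (symCheckFrom_of_range symCheck_five_5_chunkA (symCheckFrom_of_range symCheck_five_5_chunkB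
    (symCheckFrom_of_range symCheck_five_5_chunkC symCheck_five_5_chunkD)))

/-- **SAHI'S `C₅` FOR FIVE INDEPENDENT COINS**: `SahiPositive (bernoulliWeight p) 5` for every `p : Fin 5 → [0,1]`. [this work] -/
theorem sahiPositive_bernoulliWeight_five_fin_five (p : Fin 5 → unitInterval) : SahiPositive (bernoulliWeight p) 5 :=
  sahiPositive_of_symCheck (n := 3) symCheck_five_five p fun _ _ hk => SahiC4Cube.sahiPositive_bernoulliWeight_fin_five_of_le_four p hk

/-- **Sahi's `C₅` on `{0,1}^5`, events form**: `E₅(μ_p; A₀, …, A₄) ≥ 0` for increasing events under every product measure. [this work] -/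
theorem sahiC5_cube_five (p : Fin 5 → unitInterval) {A : Fin 5 → Set (Set (Fin 5))} (hA : ∀ i, IsUpperSet (A i)) :
    0 ≤ sahiE (bernoulliWeight p) 5 (fun i => ind (A i)) :=
  sahiE_ind_nonneg_of_symCheck (n := 3) symCheck_five_five p
    (fun _ _ hk => SahiC4Cube.sahiPositive_bernoulliWeight_fin_five_of_le_four p hk) hA

/-- **Sahi's conjecture at every order `n ≤ 5` for five independent coins.** [this work] -/
theorem sahiPositive_bernoulliWeight_fin_five_of_le_five (p : Fin 5 → unitInterval) {n : ℕ} (hn : n ≤ 5) :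
    SahiPositive (bernoulliWeight p) n := by
  rcases Nat.lt_or_ge n 5 with h | h
  · exact SahiC4Cube.sahiPositive_bernoulliWeight_fin_five_of_le_four p (by omega)
  · have : n = 5 := le_antisymm hn h
    subst this
    exact sahiPositive_bernoulliWeight_five_fin_five p

end Summit.CriticalPhenomena.PercolationContinuityZ3.Theorems.SahiSymCube
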